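import Mathlib.Analysis.Complex.Exponential
import Mathlib.Topology.Order.IntermediateValue
import Literature.Analysis.FluidPDE.EnergyToolkit
import HarnessLib

/-!
# Constantin's ODE lemma (Constantin 1986, Lemma 1.3), integral / bootstrap form

Analysis/FluidPDE support file (theorems only; no definitions, no named facts) on the discharge
path of `Literature.Analysis.FluidPDE.constantin_small_viscosity` (`ConstantinSmallViscosity.lean`;
P. Constantin, *Note on loss of regularity for solutions of the 3-D incompressible Euler and
related equations*, Comm. Math. Phys. 104 (1986) 311–326, §1, Thm. 1.1).

Constantin closes the `H^m` energy inequality (1.10) for the difference `w = u − v` of the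
Navier–Stokes and Euler solutions with "an elementary lemma", **Lemma 1.3** (held text
`paper:doi-10-1007-bf01211598`, MRC report version, p. 6): *for `T, G > 0`, `F ≥ 0` continuous
on `[0, T]` and `ν₀ = (8 T G ∫₀ᵀ F)⁻¹`, every nonnegative solution of `y' ≤ ν F + G y²`,
`y(0) = 0`, `0 < ν ≤ ν₀`, is bounded on `[0, T]` by `2ν∫₀ᵀ F`* — i.e. the difference stays
`O(ν)` on the whole interval on which the Euler solution is controlled, however long, once `ν` is
small. The tree's rendering of Thm. 1.1 works with the *squared* Sobolev energy
`E(t) = ‖w(t)‖²_{H^k}` in **integral form** (no time derivative of `E` is available: `E` is only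
lower semicontinuous in `t` in the Beale–Kato–Majda class), for which the energy inequality of the
companion files reads

  `E(t) ≤ ∫₀ᵗ (A E + B E^{3/2} + ν K E^{1/2}) ds`,  `E(0) = 0`,

with `A, B, K` depending only on the Euler solution. This file proves the corresponding
statement (`constantin_energy_bootstrap`): if moreover `E` is measurable, bounded on `[0, S]`,
`S ≤ T`, and *closed from the left* (`E(t) ≤ M` whenever `E ≤ M` on `[0, t)`; this is what lower
semicontinuity gives), then

  `E(t) ≤ K₀ ν²` on `[0, S]`,  `K₀ = K² T² e^{A T + 1/2}`,  whenever `ν B T K₀^{1/2} ≤ 1/4`.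

Proof (a continuity/bootstrap argument replacing Constantin's division by `(1 + y/δ)²`, which
needs differentiability): as long as `E ≤ M := K₀ν²` one has `B E^{3/2} ≤ B M^{1/2} E` and
`ν K E^{1/2} ≤ (ν²K²T + E/T)/2`, so `E ≤ a + L ∫E` with `a = ν²K²T²/2`, `L = A + B M^{1/2} + 1/(2T)`,
and Grönwall (`le_mul_exp_of_le_add_mul_integral`, applied to the continuous majorant
`a + L∫E`) gives `E ≤ a e^{LT} = (M/2) e^{ν B T K₀^{1/2}} ≤ (3/4) M` (`gronwall_stage`,
`e^{1/4} ≤ 3/2`); the set of times up to which `E ≤ M` is closed (closedness from the left) and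
open to the right (the integral inequality and boundedness of `E` give `E < M` a little further),
hence all of `[0, S]` (Mathlib `IsClosed.Icc_subset_of_forall_exists_gt`).

## Mathlib / tree search

Mathlib: `gronwallBound`, `le_gronwallBound_of_liminf_deriv_right_le` (differential form);
tree: `le_mul_exp_of_le_add_mul_integral` (`EnergyToolkit`, integral form for continuous
functions), which is used here on the primitive. No bootstrap/continuity lemma of this shape in
the tree (`lean search 'bootstrap'`: the Tao cascade files use problem-specific versions).

## References

* P. Constantin, Comm. Math. Phys. 104 (1986) 311–326, §1, Lemma 1.3 and (1.10)–(1.18)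
  (held text pp. 5–7). [Constantin1986]
-/

noncomputable section

open MeasureTheory Set Filter intervalIntegral
open scoped _root_.Topology

namespace Literature.Analysis.FluidPDE

/-! ### Elementary inequalities -/

/-- `e^{1/4} ≤ 3/2` (from Mathlib's `|eˣ − 1| ≤ 2|x|` for `|x| ≤ 1`). [folklore] -/
theorem exp_one_quarter_le : Real.exp (1 / 4) ≤ 3 / 2 := by
  have hx : |(1 / 4 : ℝ)| ≤ 1 := by rw [abs_of_pos (by norm_num)]; norm_num
  have h := Real.abs_exp_sub_one_le hx
  have h2 : Real.exp (1 / 4) - 1 ≤ 2 * |(1 / 4 : ℝ)| := (le_abs_self _).trans h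
  rw [abs_of_pos (by norm_num : (0 : ℝ) < 1 / 4)] at h2
  linarith

/-- Young's inequality for the viscous forcing term: `ν K √e ≤ (ν² K² T + e / T) / 2` for `e ≥ 0`,
`T > 0`. [folklore] -/
theorem viscous_forcing_young {ν K T e : ℝ} (hT : 0 < T) (he : 0 ≤ e) :
    ν * K * Real.sqrt e ≤ (ν ^ 2 * K ^ 2 * T + e / T) / 2 := by
  have h1 : 2 * (ν * K * T) * Real.sqrt e ≤ (ν * K * T) ^ 2 + Real.sqrt e ^ 2 :=
    two_mul_le_add_sq _ _
  rw [Real.sq_sqrt he] at h1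
  have h2 : ν * K * Real.sqrt e = (2 * (ν * K * T) * Real.sqrt e) / (2 * T) := by
    field_simp
  rw [h2, div_le_iff₀ (by positivity)]
  have h3 : (ν ^ 2 * K ^ 2 * T + e / T) / 2 * (2 * T) = (ν * K * T) ^ 2 + e := by
    field_simp
  rw [h3]
  exact h1

/-- Monotonicity of the right-hand side `Φ(e) = A e + B e √e + ν K √e` in `e ≥ 0`
(nonnegative coefficients). [folklore] -/
theorem energy_rhs_mono {A B ν K e e' : ℝ} (hA : 0 ≤ A) (hB : 0 ≤ B) (hνK : 0 ≤ ν * K)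
    (he : 0 ≤ e) (hee' : e ≤ e') :
    A * e + B * (e * Real.sqrt e) + ν * K * Real.sqrt e ≤
      A * e' + B * (e' * Real.sqrt e') + ν * K * Real.sqrt e' := by
  have hs : Real.sqrt e ≤ Real.sqrt e' := Real.sqrt_le_sqrt hee'
  have hs0 : 0 ≤ Real.sqrt e := Real.sqrt_nonneg _
  have h1 : e * Real.sqrt e ≤ e' * Real.sqrt e' :=
    mul_le_mul hee' hs hs0 (he.trans hee')
  have h2 : A * e ≤ A * e' := mul_le_mul_of_nonneg_left hee' hA
  have h3 : B * (e * Real.sqrt e) ≤ B * (e' * Real.sqrt e') := mul_le_mul_of_nonneg_left h1 hB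
  have h4 : ν * K * Real.sqrt e ≤ ν * K * Real.sqrt e' := mul_le_mul_of_nonneg_left hs hνK
  linarith

/-- The right-hand side `Φ(e)` is nonnegative for `e ≥ 0`. [folklore] -/
theorem energy_rhs_nonneg {A B ν K e : ℝ} (hA : 0 ≤ A) (hB : 0 ≤ B) (hνK : 0 ≤ ν * K)
    (he : 0 ≤ e) : 0 ≤ A * e + B * (e * Real.sqrt e) + ν * K * Real.sqrt e := by
  have := Real.sqrt_nonneg e
  positivity

/-! ### Measurability and integrability bookkeeping -/

/-- The composite `s ↦ Φ(E s)` is measurable when `E` is. [folklore] -/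
theorem measurable_energy_rhs {E : ℝ → ℝ} (hE : Measurable E) (A B ν K : ℝ) :
    Measurable fun s => A * E s + B * (E s * Real.sqrt (E s)) + ν * K * Real.sqrt (E s) := by
  have hs : Measurable fun s => Real.sqrt (E s) := Real.continuous_sqrt.measurable.comp hE
  exact ((measurable_const.mul hE).add (measurable_const.mul (hE.mul hs))).add
    (measurable_const.mul hs)

/-- A measurable function bounded on `[0, S]` is integrable there. [folklore] -/
theorem integrableOn_Icc_of_measurable_bound {f : ℝ → ℝ} (hf : Measurable f) {S C : ℝ}
    (hC : ∀ s ∈ Icc 0 S, |f s| ≤ C) : IntegrableOn f (Icc 0 S) := by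
  refine Measure.integrableOn_of_bounded (M := C) measure_Icc_lt_top.ne
    hf.aestronglyMeasurable ?_
  rw [ae_restrict_iff' measurableSet_Icc]
  exact Eventually.of_forall fun s hs => by rw [Real.norm_eq_abs]; exact hC s hs

/-! ### The Grönwall stage: as long as `E ≤ M` -/

/-- **The linear stage.** Let `E ≥ 0` be measurable with `E ≤ M` on `[0, t₀]`, `0 ≤ t₀ ≤ T`,
and `E(t) ≤ ∫₀ᵗ (A E + B E√E + ν K √E)` for `t ∈ [0, t₀]` (`A, B, K, ν ≥ 0`, `T > 0`). Then, with
`a = ν²K²T²/2` and `L = A + B√M + 1/(2T)`, both `E(t)` and `∫₀ᵗ (A E + B E√E + ν K √E)` are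
`≤ a e^{L t}` on `[0, t₀]` (linearise `B E√E ≤ B√M E`, `νK√E ≤ (ν²K²T + E/T)/2`, and apply the
integral Grönwall inequality to the continuous majorant `a + L∫₀ᵗ E`). This is the mechanism of
Constantin 1986, (1.10)–(1.11) and Lemma 1.3. [cite: Constantin1986, §1 Lemma 1.3 and (1.10)-(1.11)] -/
theorem gronwall_stage {A B K ν T M t₀ : ℝ} (hA : 0 ≤ A) (hB : 0 ≤ B) (hK : 0 ≤ K) (hν : 0 ≤ ν)
    (hT : 0 < T) (ht₀ : 0 ≤ t₀) (ht₀T : t₀ ≤ T) {E : ℝ → ℝ} (hEm : Measurable E)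
    (hE0 : ∀ s ∈ Icc 0 t₀, 0 ≤ E s) (hEM : ∀ s ∈ Icc 0 t₀, E s ≤ M)
    (hint : ∀ t ∈ Icc 0 t₀, E t ≤ ∫ s in Ioo 0 t,
      (A * E s + B * (E s * Real.sqrt (E s)) + ν * K * Real.sqrt (E s))) :
    ∀ t ∈ Icc 0 t₀,
      E t ≤ ν ^ 2 * K ^ 2 * T ^ 2 / 2 * Real.exp ((A + B * Real.sqrt M + 1 / (2 * T)) * t) ∧
      (∫ s in Ioo 0 t, (A * E s + B * (E s * Real.sqrt (E s)) + ν * K * Real.sqrt (E s))) ≤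
        ν ^ 2 * K ^ 2 * T ^ 2 / 2 * Real.exp ((A + B * Real.sqrt M + 1 / (2 * T)) * t) := by
  set a : ℝ := ν ^ 2 * K ^ 2 * T ^ 2 / 2 with ha
  set L : ℝ := A + B * Real.sqrt M + 1 / (2 * T) with hL
  set c : ℝ := ν ^ 2 * K ^ 2 * T / 2 with hc
  set Φ : ℝ → ℝ := fun s => A * E s + B * (E s * Real.sqrt (E s)) + ν * K * Real.sqrt (E s)
    with hΦ
  have hνK : 0 ≤ ν * K := mul_nonneg hν hK
  have hL0 : 0 ≤ L := by rw [hL]; positivity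
  have ha0 : 0 ≤ a := by rw [ha]; positivity
  have hc0 : 0 ≤ c := by rw [hc]; positivity
  -- the linearised pointwise bound
  have hΦle : ∀ s ∈ Icc 0 t₀, Φ s ≤ L * E s + c := by
    intro s hs
    have he := hE0 s hs
    have h1 : E s * Real.sqrt (E s) ≤ Real.sqrt M * E s := by
      rw [mul_comm]
      exact mul_le_mul_of_nonneg_right (Real.sqrt_le_sqrt (hEM s hs)) he
    have h2 := viscous_forcing_young (ν := ν) (K := K) hT he
    have h3 : B * (E s * Real.sqrt (E s)) ≤ B * (Real.sqrt M * E s) := mul_le_mul_of_nonneg_left h1 hB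
    simp only [hΦ, hL, hc]
    have h4 : (ν ^ 2 * K ^ 2 * T + E s / T) / 2 = 1 / (2 * T) * E s + ν ^ 2 * K ^ 2 * T / 2 := by
      field_simp
      ring
    rw [h4] at h2
    nlinarith
  have hΦ0 : ∀ s ∈ Icc 0 t₀, 0 ≤ Φ s := fun s hs => energy_rhs_nonneg hA hB hνK (hE0 s hs)
  -- integrability on `[0, t₀]`
  have hEint : IntegrableOn E (Icc 0 t₀) := by
    refine integrableOn_Icc_of_measurable_bound hEm (C := M) fun s hs => ?_
    rw [abs_of_nonneg (hE0 s hs)]; exact hEM s hs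
  have hΦm : Measurable Φ := measurable_energy_rhs hEm A B ν K
  have hΦint : IntegrableOn Φ (Icc 0 t₀) := by
    refine integrableOn_Icc_of_measurable_bound hΦm (C := L * M + c) fun s hs => ?_
    rw [abs_of_nonneg (hΦ0 s hs)]
    exact (hΦle s hs).trans (by nlinarith [hEM s hs, hL0])
  have hEii : ∀ {x y}, x ∈ Icc 0 t₀ → y ∈ Icc 0 t₀ → IntervalIntegrable E volume x y :=
    fun hx hy => (hEint.mono_set (uIcc_subset_Icc hx hy)).intervalIntegrable
  have hΦii : ∀ {x y}, x ∈ Icc 0 t₀ → y ∈ Icc 0 t₀ → IntervalIntegrable Φ volume x y :=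
    fun hx hy => (hΦint.mono_set (uIcc_subset_Icc hx hy)).intervalIntegrable
  have h0I : (0 : ℝ) ∈ Icc 0 t₀ := ⟨le_rfl, ht₀⟩
  -- the continuous majorant `Z t = a + L ∫₀ᵗ E`
  set Z : ℝ → ℝ := fun t => a + L * ∫ s in (0 : ℝ)..t, E s with hZ
  have hZcont : ContinuousOn Z (Icc 0 t₀) := by
    have hprim : ContinuousOn (fun t => ∫ s in (0 : ℝ)..t, E s) (Icc 0 t₀) := by
      have h := continuousOn_primitive_interval (μ := volume) (f := E) (a := 0) (b := t₀)
        (by rw [uIcc_of_le ht₀]; exact hEint)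
      rwa [uIcc_of_le ht₀] at h
    exact continuousOn_const.add (hprim.const_smul L |>.congr fun t _ => by simp [smul_eq_mul])
  -- conversion of the hypothesis to interval integrals
  have hIoo : ∀ {f : ℝ → ℝ} {t : ℝ}, 0 ≤ t → ∫ s in Ioo 0 t, f s = ∫ s in (0 : ℝ)..t, f s := by
    intro f t ht
    rw [intervalIntegral.integral_of_le ht, integral_Ioc_eq_integral_Ioo]
  -- `∫₀ᵗ Φ ≤ Z t` and `E t ≤ Z t`
  have hPZ : ∀ t ∈ Icc 0 t₀, (∫ s in (0 : ℝ)..t, Φ s) ≤ Z t := by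
    intro t ht
    have h1 : (∫ s in (0 : ℝ)..t, Φ s) ≤ ∫ s in (0 : ℝ)..t, (L * E s + c) :=
      intervalIntegral.integral_mono_on ht.1 (hΦii h0I ht)
        (((hEii h0I ht).const_mul L).add intervalIntegrable_const)
        fun s hs => hΦle s ⟨hs.1, hs.2.trans ht.2⟩
    have h2 : (∫ s in (0 : ℝ)..t, (L * E s + c)) = L * (∫ s in (0 : ℝ)..t, E s) + t * c := by
      rw [intervalIntegral.integral_add ((hEii h0I ht).const_mul L) intervalIntegrable_const,
        intervalIntegral.integral_const_mul, intervalIntegral.integral_const, sub_zero, smul_eq_mul]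
    have h3 : t * c ≤ a := by
      rw [ha, hc]
      have : t ≤ T := ht.2.trans ht₀T
      nlinarith [mul_nonneg (mul_nonneg (sq_nonneg ν) (sq_nonneg K)) hT.le]
    rw [hZ]
    linarith
  have hEZ : ∀ t ∈ Icc 0 t₀, E t ≤ Z t := fun t ht => by
    have := hint t ht
    rw [hIoo ht.1] at this
    exact this.trans (hPZ t ht)
  -- Grönwall for `Z`
  have hZle : ∀ t ∈ Icc 0 t₀, Z t ≤ a + L * ∫ s in (0 : ℝ)..t, Z s := by
    intro t ht
    have hmono : (∫ s in (0 : ℝ)..t, E s) ≤ ∫ s in (0 : ℝ)..t, Z s :=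
      intervalIntegral.integral_mono_on ht.1 (hEii h0I ht)
        ((hZcont.mono (Icc_subset_Icc le_rfl ht.2)).intervalIntegrable_of_Icc ht.1)
        fun s hs => hEZ s ⟨hs.1, hs.2.trans ht.2⟩
    rw [hZ]
    exact add_le_add le_rfl (mul_le_mul_of_nonneg_left hmono hL0)
  have hG := le_mul_exp_of_le_add_mul_integral hZcont hL0 hZle
  intro t ht
  refine ⟨(hEZ t ht).trans (hG t ht), ?_⟩
  rw [hIoo ht.1]
  exact (hPZ t ht).trans (hG t ht)

/-! ### The bootstrap -/

/-- **Constantin's ODE lemma, integral form (Constantin 1986, Lemma 1.3, for the squared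
energy).** Let `T ≥ S > 0`, `A, B ≥ 0`, `K > 0`, `ν > 0`, and let `E : ℝ → ℝ` be measurable,
with `0 ≤ E ≤ E_max` on `[0, S]`, `E(0) = 0`, closed from the left on `(0, S]`
(`E(t) ≤ M` whenever `E ≤ M` on `[0, t)`, for every `M`), and satisfying the energy inequality
`E(t) ≤ ∫₀ᵗ (A E + B E√E + ν K √E) ds` for `t ∈ [0, S]`. Put `K₀ = K² T² e^{A T + 1/2}`. If
`ν B T √K₀ ≤ 1/4`, then `E(t) ≤ K₀ ν²` for all `t ∈ [0, S]`. (Printed form: for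
`y' ≤ νF + Gy²`, `y(0) = 0`, `0 < ν ≤ ν₀ = (8TG∫₀ᵀF)⁻¹`, `y(t) ≤ 2ν∫₀ᵀ F`; here `y² = E`,
the linear term `A E` is kept instead of being absorbed by an integrating factor, and the
smallness of `ν` again makes the quadratic term harmless on the whole of `[0, T]`.)
[cite: Constantin1986, §1 Lemma 1.3] -/
theorem constantin_energy_bootstrap {S T A B K ν Emax : ℝ} (hS : 0 < S) (hST : S ≤ T)
    (hA : 0 ≤ A) (hB : 0 ≤ B) (hK : 0 < K) (hν : 0 < ν) {E : ℝ → ℝ} (hEm : Measurable E)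
    (hE0 : ∀ t ∈ Icc 0 S, 0 ≤ E t) (hEmax : ∀ t ∈ Icc 0 S, E t ≤ Emax) (hE00 : E 0 = 0)
    (hclosed : ∀ t ∈ Ioc 0 S, ∀ M : ℝ, (∀ s ∈ Ico 0 t, E s ≤ M) → E t ≤ M)
    (hint : ∀ t ∈ Icc 0 S, E t ≤ ∫ s in Ioo 0 t,
      (A * E s + B * (E s * Real.sqrt (E s)) + ν * K * Real.sqrt (E s)))
    (hsmall : ν * (B * T * Real.sqrt (K ^ 2 * T ^ 2 * Real.exp (A * T + 1 / 2))) ≤ 1 / 4) :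
    ∀ t ∈ Icc 0 S, E t ≤ K ^ 2 * T ^ 2 * Real.exp (A * T + 1 / 2) * ν ^ 2 := by
  have hT : 0 < T := hS.trans_le hST
  set K₀ : ℝ := K ^ 2 * T ^ 2 * Real.exp (A * T + 1 / 2) with hK₀
  have hK₀pos : 0 < K₀ := by rw [hK₀]; positivity
  set M : ℝ := K₀ * ν ^ 2 with hM
  have hMpos : 0 < M := by rw [hM]; positivity
  have hνK : 0 ≤ ν * K := by positivity
  have hEmax0 : 0 ≤ Emax := (hE0 0 ⟨le_rfl, hS.le⟩).trans (hEmax 0 ⟨le_rfl, hS.le⟩)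
  set Φ : ℝ → ℝ := fun s => A * E s + B * (E s * Real.sqrt (E s)) + ν * K * Real.sqrt (E s)
    with hΦ
  set Φmax : ℝ := A * Emax + B * (Emax * Real.sqrt Emax) + ν * K * Real.sqrt Emax with hΦmax
  have hΦmax0 : 0 ≤ Φmax := energy_rhs_nonneg hA hB hνK hEmax0
  have hΦle : ∀ s ∈ Icc 0 S, Φ s ≤ Φmax := fun s hs =>
    energy_rhs_mono hA hB hνK (hE0 s hs) (hEmax s hs)
  have hΦ0 : ∀ s ∈ Icc 0 S, 0 ≤ Φ s := fun s hs => energy_rhs_nonneg hA hB hνK (hE0 s hs)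
  set δ : ℝ := M / (4 * Φmax + 4) with hδ
  have hδpos : 0 < δ := by rw [hδ]; positivity
  have hδΦ : δ * Φmax ≤ M / 4 := by
    rw [hδ, div_mul_eq_mul_div, div_le_div_iff₀ (by positivity) (by norm_num)]
    nlinarith
  -- `√M = √K₀ ν` and the exponential factor
  have hsqrtM : Real.sqrt M = Real.sqrt K₀ * ν := by
    rw [hM, Real.sqrt_mul hK₀pos.le, Real.sqrt_sq hν.le]
  have hexp : Real.exp (B * Real.sqrt M * T) ≤ 3 / 2 := by
    refine le_trans (Real.exp_le_exp.2 ?_) exp_one_quarter_le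
    rw [hsqrtM]
    calc B * (Real.sqrt K₀ * ν) * T = ν * (B * T * Real.sqrt K₀) := by ring
      _ ≤ 1 / 4 := hsmall
  -- integrability of `Φ` on `[0, S]`
  have hΦm : Measurable Φ := measurable_energy_rhs hEm A B ν K
  have hΦint : IntegrableOn Φ (Icc 0 S) :=
    integrableOn_Icc_of_measurable_bound hΦm (C := Φmax) fun s hs => by
      rw [abs_of_nonneg (hΦ0 s hs)]; exact hΦle s hs
  have hΦii : ∀ {x y}, x ∈ Icc 0 S → y ∈ Icc 0 S → IntervalIntegrable Φ volume x y :=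
    fun hx hy => (hΦint.mono_set (uIcc_subset_Icc hx hy)).intervalIntegrable
  have hIoo : ∀ {t : ℝ}, 0 ≤ t → ∫ s in Ioo 0 t, Φ s = ∫ s in (0 : ℝ)..t, Φ s := by
    intro t ht
    rw [intervalIntegral.integral_of_le ht, integral_Ioc_eq_integral_Ioo]
  /- the key stage: if `E ≤ M` on `[0, t₀]` then `E ≤ 3M/4` there and `∫₀^{t₀} Φ ≤ 3M/4` -/
  have hstage : ∀ t₀ ∈ Icc 0 S, (∀ s ∈ Icc 0 t₀, E s ≤ M) →
      (∀ s ∈ Icc 0 t₀, E s ≤ 3 / 4 * M) ∧ (∫ s in Ioo 0 t₀, Φ s) ≤ 3 / 4 * M := by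
    intro t₀ ht₀ hEM
    have hsub : Icc 0 t₀ ⊆ Icc 0 S := Icc_subset_Icc le_rfl ht₀.2
    have hG := gronwall_stage hA hB hK.le hν.le hT ht₀.1 (ht₀.2.trans hST) hEm
      (fun s hs => hE0 s (hsub hs)) hEM (fun t ht => hint t (hsub ht))
    -- the common bound `a e^{L t} ≤ 3M/4`
    have hbound : ∀ t ∈ Icc 0 t₀, ν ^ 2 * K ^ 2 * T ^ 2 / 2 *
        Real.exp ((A + B * Real.sqrt M + 1 / (2 * T)) * t) ≤ 3 / 4 * M := by
      intro t ht
      have htT : t ≤ T := ht.2.trans (ht₀.2.trans hST)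
      have h1 : Real.exp ((A + B * Real.sqrt M + 1 / (2 * T)) * t) ≤
          Real.exp ((A + B * Real.sqrt M + 1 / (2 * T)) * T) :=
        Real.exp_le_exp.2 (mul_le_mul_of_nonneg_left htT (by positivity))
      have h2 : (A + B * Real.sqrt M + 1 / (2 * T)) * T = (A * T + 1 / 2) + B * Real.sqrt M * T := by
        field_simp
        ring
      rw [h2, Real.exp_add] at h1
      have h3 : ν ^ 2 * K ^ 2 * T ^ 2 / 2 * (Real.exp (A * T + 1 / 2) * Real.exp (B * Real.sqrt M * T))
          ≤ ν ^ 2 * K ^ 2 * T ^ 2 / 2 * (Real.exp (A * T + 1 / 2) * (3 / 2)) := by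
        gcongr
      have h4 : ν ^ 2 * K ^ 2 * T ^ 2 / 2 * (Real.exp (A * T + 1 / 2) * (3 / 2)) = 3 / 4 * M := by
        rw [hM, hK₀]; ring
      calc ν ^ 2 * K ^ 2 * T ^ 2 / 2 * Real.exp ((A + B * Real.sqrt M + 1 / (2 * T)) * t)
          ≤ ν ^ 2 * K ^ 2 * T ^ 2 / 2 * (Real.exp (A * T + 1 / 2) * Real.exp (B * Real.sqrt M * T)) :=
            mul_le_mul_of_nonneg_left h1 (by positivity)
        _ ≤ _ := h3
        _ = 3 / 4 * M := h4
    exact ⟨fun s hs => (hG s hs).1.trans (hbound s hs), (hG t₀ ⟨ht₀.1, le_rfl⟩).2.trans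
      (hbound t₀ ⟨ht₀.1, le_rfl⟩)⟩
  /- the bootstrap set -/
  set 𝒮 : Set ℝ := {t | ∀ s ∈ Icc (0 : ℝ) S, s ≤ t → E s ≤ M} with h𝒮
  have hmem : ∀ {t}, t ∈ 𝒮 ↔ ∀ s ∈ Icc (0 : ℝ) S, s ≤ t → E s ≤ M := fun {t} => Iff.rfl
  -- `0 ∈ 𝒮`
  have h0 : (0 : ℝ) ∈ 𝒮 := by
    rw [hmem]
    intro s hs hs0
    have : s = 0 := le_antisymm hs0 hs.1
    rw [this, hE00]
    exact hMpos.le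
  -- closedness of `𝒮 ∩ [0, S]`
  have hcl : IsClosed (𝒮 ∩ Icc 0 S) := by
    refine IsSeqClosed.isClosed fun x t hx hxt => ?_
    have htI : t ∈ Icc 0 S :=
      isClosed_Icc.mem_of_tendsto hxt (Eventually.of_forall fun n => (hx n).2)
    refine ⟨?_, htI⟩
    rw [hmem]
    intro s hs hst
    rcases hst.lt_or_eq with hlt | heq
    · obtain ⟨n, hn⟩ := (hxt.eventually_const_lt hlt).exists
      exact (hmem.1 (hx n).1) s hs hn.le
    · subst heq
      rcases hs.1.eq_or_lt with h00 | hpos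
      · rw [← h00, hE00]; exact hMpos.le
      · refine hclosed s ⟨hpos, hs.2⟩ M fun s' hs' => ?_
        obtain ⟨n, hn⟩ := (hxt.eventually_const_lt hs'.2).exists
        exact (hmem.1 (hx n).1) s' ⟨hs'.1, hs'.2.le.trans hs.2⟩ hn.le
  -- openness to the right
  have hgt : ∀ x ∈ 𝒮 ∩ Ico 0 S, ∀ y ∈ Ioi x, (𝒮 ∩ Ioc x y).Nonempty := by
    rintro x ⟨hx, hxI⟩ y hy
    set z : ℝ := min (x + δ) (min y S) with hz
    have hxz : x < z := lt_min (by linarith) (lt_min hy hxI.2)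
    have hzy : z ≤ y := (min_le_right _ _).trans (min_le_left _ _)
    have hzS : z ≤ S := (min_le_right _ _).trans (min_le_right _ _)
    have hzδ : z ≤ x + δ := min_le_left _ _
    refine ⟨z, ?_, hxz, hzy⟩
    rw [hmem]
    intro s hs hsz
    by_cases hsx : s ≤ x
    · exact (hmem.1 hx) s hs hsx
    rw [not_le] at hsx
    -- `E ≤ M` on `[0, x]`, hence the stage bound at `x`
    have hxI' : x ∈ Icc 0 S := ⟨hxI.1, hxI.2.le⟩
    have hEMx : ∀ s' ∈ Icc 0 x, E s' ≤ M := fun s' hs' =>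
      (hmem.1 hx) s' ⟨hs'.1, hs'.2.trans hxI.2.le⟩ hs'.2
    have hPx := (hstage x hxI' hEMx).2
    rw [hIoo hxI.1] at hPx
    -- split the integral at `x`
    have hsplit : (∫ τ in (0 : ℝ)..s, Φ τ) = (∫ τ in (0 : ℝ)..x, Φ τ) + ∫ τ in x..s, Φ τ :=
      (intervalIntegral.integral_add_adjacent_intervals (hΦii ⟨le_rfl, hS.le⟩ hxI')
        (hΦii hxI' hs)).symm
    have htail : (∫ τ in x..s, Φ τ) ≤ (s - x) * Φmax := by
      have h1 : (∫ τ in x..s, Φ τ) ≤ ∫ _ in x..s, Φmax :=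
        intervalIntegral.integral_mono_on hsx.le (hΦii hxI' hs) intervalIntegrable_const
          fun τ hτ => hΦle τ ⟨hxI.1.trans hτ.1, hτ.2.trans hs.2⟩
      rwa [intervalIntegral.integral_const, smul_eq_mul] at h1
    have hsx' : (s - x) * Φmax ≤ δ * Φmax :=
      mul_le_mul_of_nonneg_right (by linarith) hΦmax0
    have := hint s hs
    rw [hIoo hs.1, hsplit] at this
    linarith
  have hall := hcl.Icc_subset_of_forall_exists_gt (a := 0) (b := S) h0 hgt
  intro t ht
  exact (hmem.1 (hall ht)) t ht le_rfl

end Literature.Analysis.FluidPDE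

end
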